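import Mathlib
import Summits.QuantumFields.YangMills.Theorems.ConvexGribovBodyContinuumLegGivenGapStubCsclIvCSA
import Summits.QuantumFields.YangMills.Theorems.ConvexGribovBodyContinuumLegGivenGapStubCsclTorusRP
import HarnessLib

/-!
# `ContinuumLegGivenGap` (stmt-QuantumFields-15828), line `Sketch`, reshape 18: `stub_csclIvCS` — lock + reflection positivity ⇒
# asymptotic Osterwalder–Schrader Cauchy–Schwarz clustering along growing tori, constants-free

Support file for the crux item stmt-QuantumFields-15828 (registered glue stub `stub_csclIvCS` of line `Sketch`, reshape 18).
At one coupling `β ≥ 0` with the locked volume-uniform lattice gap at rate `μ` (ONE constant per pair of local gauge-invariant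
observables on all tori `S ≥ S₁`, `n ≤ S`), along a strictly increasing sequence of tori `S_j ≥ S₁` on which the pairings
`𝒫_σ(X,Y) = ∫ conj X(cfgReflect Ũ) Y(τ^σ Ũ) dμ` and means of two FIXED bounded measurable complex cylinder observables `X, Y`
(links at times `1 … v`; real/imaginary parts of `X`, `X ∘ cfgReflect` local gauge-invariant) converge: for every `σ` and `ε > 0`,
eventually in `j`, `‖𝒫_σ(X°,Y°)‖ ≤ e^{−μσ} √𝒫₀(X°,X°) √𝒫₀(Y°,Y°) + ε` (`X° = X − E X`).
Proof (`ivcs_main`): by the landed torus RP package `stub_csclTorusRP` applied to the centred observables, `σ ↦ Re 𝒫^{S_j}_σ(X°,X°)`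
is non-negative, real and midpoint log-convex on `σ ≤ S_j − v − 3`; at the far point it is bounded by four locked connected
correlations (`ivcs_far_bound`, part A), `≤ (ΣC) e^{−μσ}`; the chord limit (`csclReal_chordLimit`, landed) gives
`gl(2σ) ≤ gl(0) e^{−2μσ}`; the cross term by `stub_csclTorusRP` (c) with `(a, c) = (σ, 0)`; limits (`ivcs_abstract`, part A), after
shifting the index so that `v + 3 ≤ S_j`. No definitions, no facts; Mathlib + landed tree lemmas only. [folklore]
-/

noncomputable section

namespace Summit.QuantumFields.YangMills.Theorems.ContinuumLegGivenGap

open scoped SchwartzMap ComplexConjugate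
open Filter Topology MeasureTheory
open Literature.MathematicalPhysics.QuantumFieldTheory Literature.MathematicalPhysics.QuantumLattice
  Literature.MathematicalPhysics.AQFT Literature.Probability.LatticeModels

/-- **Main lemma** (= the registered `stub_csclIvCS`; see the module docstring). [folklore] -/
theorem ivcs_main :
    ∀ (G : Type) [Group G] [TopologicalSpace G] [IsTopologicalGroup G] [CompactSpace G]
      [MeasurableSpace G] [BorelSpace G] (r : LatticeRep G) (β μ : ℝ) (S₁ v : ℕ) (Sq : ℕ → ℕ)
      (X Y : LGConfig 4 G → ℂ) (ΛX ΛY : Finset (Literature.MathematicalPhysics.QuantumLattice.ZdEdge 4)),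
      0 ≤ β → 0 < μ → StrictMono Sq → (∀ j, S₁ ≤ Sq j) →
      Measurable X → Measurable Y → (∃ C : ℝ, ∀ V, ‖X V‖ ≤ C) → (∃ C : ℝ, ∀ V, ‖Y V‖ ≤ C) →
      IsCylinder X ΛX → IsCylinder Y ΛY →
      (∀ e ∈ ΛX, 1 ≤ e.1 0 ∧ e.1 0 ≤ (v : ℤ)) → (∀ e ∈ ΛY, 1 ≤ e.1 0 ∧ e.1 0 ≤ (v : ℤ)) →
      (∀ A B : YMSpecies G, ∃ C : ℝ, ∀ S n : ℕ, S₁ ≤ S → n ≤ S →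
        |latticeConnectedCorr r.ρ β (2 * S + 1) A.F B.F n| ≤ C * Real.exp (-(μ * n))) →
      (∃ A₁ A₂ A₃ A₄ : YMSpecies G,
        (∀ V, A₁.F V = (X (cfgReflect V)).re) ∧ (∀ V, A₂.F V = (X (cfgReflect V)).im) ∧
        (∀ V, A₃.F V = (X V).re) ∧ (∀ V, A₄.F V = (X V).im)) →
      (∀ σ : ℕ,
        (∃ l : ℂ, Tendsto (fun j : ℕ => ∫ U : GaugeConfig 4 (2 * Sq j + 1) G, (starRingEnd ℂ) (X (cfgReflect (torusLift (2 * Sq j + 1) U))) * X (configShift (-(Pi.single 0 ((σ : ℕ) : ℤ))) (torusLift (2 * Sq j + 1) U)) ∂(wilsonMeasure r.ρ β)) atTop (𝓝 l)) ∧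
        (∃ l : ℂ, Tendsto (fun j : ℕ => ∫ U : GaugeConfig 4 (2 * Sq j + 1) G, (starRingEnd ℂ) (Y (cfgReflect (torusLift (2 * Sq j + 1) U))) * Y (configShift (-(Pi.single 0 ((σ : ℕ) : ℤ))) (torusLift (2 * Sq j + 1) U)) ∂(wilsonMeasure r.ρ β)) atTop (𝓝 l)) ∧
        (∃ l : ℂ, Tendsto (fun j : ℕ => ∫ U : GaugeConfig 4 (2 * Sq j + 1) G, (starRingEnd ℂ) (X (cfgReflect (torusLift (2 * Sq j + 1) U))) * Y (configShift (-(Pi.single 0 ((σ : ℕ) : ℤ))) (torusLift (2 * Sq j + 1) U)) ∂(wilsonMeasure r.ρ β)) atTop (𝓝 l))) →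
      (∃ l : ℂ, Tendsto (fun j : ℕ => ∫ U : GaugeConfig 4 (2 * Sq j + 1) G, X (torusLift (2 * Sq j + 1) U) ∂(wilsonMeasure r.ρ β)) atTop (𝓝 l)) →
      (∃ l : ℂ, Tendsto (fun j : ℕ => ∫ U : GaugeConfig 4 (2 * Sq j + 1) G, Y (torusLift (2 * Sq j + 1) U) ∂(wilsonMeasure r.ρ β)) atTop (𝓝 l)) →
      ∀ (σ : ℕ) (ε : ℝ), 0 < ε → ∀ᶠ j : ℕ in atTop,
        ‖(∫ U : GaugeConfig 4 (2 * Sq j + 1) G, (starRingEnd ℂ) (X (cfgReflect (torusLift (2 * Sq j + 1) U))) * Y (configShift (-(Pi.single 0 ((σ : ℕ) : ℤ))) (torusLift (2 * Sq j + 1) U)) ∂(wilsonMeasure r.ρ β)) -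
            (starRingEnd ℂ) (∫ U : GaugeConfig 4 (2 * Sq j + 1) G, X (torusLift (2 * Sq j + 1) U) ∂(wilsonMeasure r.ρ β)) * (∫ U : GaugeConfig 4 (2 * Sq j + 1) G, Y (torusLift (2 * Sq j + 1) U) ∂(wilsonMeasure r.ρ β))‖ ≤
          Real.exp (-(μ * σ)) *
            Real.sqrt ((∫ U : GaugeConfig 4 (2 * Sq j + 1) G, (starRingEnd ℂ) (X (cfgReflect (torusLift (2 * Sq j + 1) U))) * X (configShift (-(Pi.single 0 ((0 : ℕ) : ℤ))) (torusLift (2 * Sq j + 1) U)) ∂(wilsonMeasure r.ρ β)) -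
              (starRingEnd ℂ) (∫ U : GaugeConfig 4 (2 * Sq j + 1) G, X (torusLift (2 * Sq j + 1) U) ∂(wilsonMeasure r.ρ β)) * (∫ U : GaugeConfig 4 (2 * Sq j + 1) G, X (torusLift (2 * Sq j + 1) U) ∂(wilsonMeasure r.ρ β))).re *
            Real.sqrt ((∫ U : GaugeConfig 4 (2 * Sq j + 1) G, (starRingEnd ℂ) (Y (cfgReflect (torusLift (2 * Sq j + 1) U))) * Y (configShift (-(Pi.single 0 ((0 : ℕ) : ℤ))) (torusLift (2 * Sq j + 1) U)) ∂(wilsonMeasure r.ρ β)) -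
              (starRingEnd ℂ) (∫ U : GaugeConfig 4 (2 * Sq j + 1) G, Y (torusLift (2 * Sq j + 1) U) ∂(wilsonMeasure r.ρ β)) * (∫ U : GaugeConfig 4 (2 * Sq j + 1) G, Y (torusLift (2 * Sq j + 1) U) ∂(wilsonMeasure r.ρ β))).re + ε := by
  intro G _ _ _ _ _ _ r β μ S₁ v Sq X Y ΛX ΛY hβ hμ hSq hS₁ hXm hYm hXb hYb hXc hYc hΛX hΛY hlock hspec hconv hEX hEY
    σ ε hε
  obtain ⟨A₁, A₂, A₃, A₄, h₁, h₂, h₃, h₄⟩ := hspec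
  -- abbreviations (definitional): pairing and mean on the torus of side `2S+1`
  set P : ℕ → ℕ → (LGConfig 4 G → ℂ) → (LGConfig 4 G → ℂ) → ℂ := fun S s X' Y' =>
    ∫ U : GaugeConfig 4 (2 * S + 1) G, (starRingEnd ℂ) (X' (cfgReflect (torusLift (2 * S + 1) U))) *
      Y' (configShift (-(Pi.single 0 ((s : ℕ) : ℤ))) (torusLift (2 * S + 1) U)) ∂(wilsonMeasure r.ρ β) with hP
  set E : ℕ → (LGConfig 4 G → ℂ) → ℂ := fun S X' =>
    ∫ U : GaugeConfig 4 (2 * S + 1) G, X' (torusLift (2 * S + 1) U) ∂(wilsonMeasure r.ρ β) with hE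
  change ∀ᶠ j : ℕ in atTop, ‖P (Sq j) σ X Y - (starRingEnd ℂ) (E (Sq j) X) * E (Sq j) Y‖ ≤
    Real.exp (-(μ * σ)) * Real.sqrt ((P (Sq j) 0 X X - (starRingEnd ℂ) (E (Sq j) X) * E (Sq j) X).re) *
      Real.sqrt ((P (Sq j) 0 Y Y - (starRingEnd ℂ) (E (Sq j) Y) * E (Sq j) Y).re) + ε
  -- limits of pairings and means
  obtain ⟨eX, heX⟩ := hEX
  obtain ⟨eY, heY⟩ := hEY
  change Tendsto (fun j => E (Sq j) X) atTop (𝓝 eX) at heX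
  change Tendsto (fun j => E (Sq j) Y) atTop (𝓝 eY) at heY
  have hPXX : ∀ s : ℕ, ∃ l : ℂ, Tendsto (fun j => P (Sq j) s X X) atTop (𝓝 l) := fun s => (hconv s).1
  have hPYY : ∃ l : ℂ, Tendsto (fun j => P (Sq j) 0 Y Y) atTop (𝓝 l) := (hconv 0).2.1
  have hPXY : ∃ l : ℂ, Tendsto (fun j => P (Sq j) σ X Y) atTop (𝓝 l) := (hconv σ).2.2
  choose lXX hlXX using hPXX
  obtain ⟨lYY, hlYY⟩ := hPYY
  obtain ⟨lXY, hlXY⟩ := hPXY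
  -- the centred observables on the torus `Sq j` and their RP package
  have hcX : ∀ j, Measurable (fun V => X V - E (Sq j) X) ∧ (∃ C : ℝ, ∀ V, ‖X V - E (Sq j) X‖ ≤ C) ∧
      IsCylinder (fun V => X V - E (Sq j) X) ΛX := fun j => by
    obtain ⟨C, hC⟩ := hXb
    exact ⟨hXm.sub measurable_const, ⟨C + ‖E (Sq j) X‖, fun V => (norm_sub_le _ _).trans
      (add_le_add (hC V) le_rfl)⟩, fun U V hUV => by simp only [hXc hUV]⟩
  have hcY : ∀ j, Measurable (fun V => Y V - E (Sq j) Y) ∧ (∃ C : ℝ, ∀ V, ‖Y V - E (Sq j) Y‖ ≤ C) ∧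
      IsCylinder (fun V => Y V - E (Sq j) Y) ΛY := fun j => by
    obtain ⟨C, hC⟩ := hYb
    exact ⟨hYm.sub measurable_const, ⟨C + ‖E (Sq j) Y‖, fun V => (norm_sub_le _ _).trans
      (add_le_add (hC V) le_rfl)⟩, fun U V hUV => by simp only [hYc hUV]⟩
  -- centring identities: the pairing of centred observables is the centred pairing
  have hcen : ∀ (j s : ℕ) (X' Y' : LGConfig 4 G → ℂ), Measurable X' → Measurable Y' →
      (∃ C : ℝ, ∀ V, ‖X' V‖ ≤ C) → (∃ C : ℝ, ∀ V, ‖Y' V‖ ≤ C) →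
      P (Sq j) s (fun V => X' V - E (Sq j) X') (fun V => Y' V - E (Sq j) Y') =
        P (Sq j) s X' Y' - (starRingEnd ℂ) (E (Sq j) X') * E (Sq j) Y' := by
    intro j s X' Y' hX'm hY'm hX'b hY'b
    simp only [hP, hE]
    exact ivcs_centred r.ρ r.continuous β (2 * Sq j + 1) hX'm hY'm hX'b hY'b ((s : ℕ) : ℤ)
  -- the RP packages of the centred observables on the torus `Sq j`
  have hRP := fun j => stub_csclTorusRP G r β hβ (Sq j) v (fun V => X V - E (Sq j) X) (fun V => Y V - E (Sq j) Y)
    ΛX ΛY (hcX j).1 (hcY j).1 (hcX j).2.1 (hcY j).2.1 (hcX j).2.2 (hcY j).2.2 hΛX hΛY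
  have hRPY := fun j => (stub_csclTorusRP G r β hβ (Sq j) v (fun V => Y V - E (Sq j) Y) (fun V => Y V - E (Sq j) Y)
    ΛY ΛY (hcY j).1 (hcY j).1 (hcY j).2.1 (hcY j).2.1 (hcY j).2.2 (hcY j).2.2 hΛY hΛY).1
  have hcenXX : ∀ j s, P (Sq j) s (fun V => X V - E (Sq j) X) (fun V => X V - E (Sq j) X) =
      P (Sq j) s X X - (starRingEnd ℂ) (E (Sq j) X) * E (Sq j) X := fun j s => hcen j s X X hXm hXm hXb hXb
  have hcenYY : ∀ j s, P (Sq j) s (fun V => Y V - E (Sq j) Y) (fun V => Y V - E (Sq j) Y) =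
      P (Sq j) s Y Y - (starRingEnd ℂ) (E (Sq j) Y) * E (Sq j) Y := fun j s => hcen j s Y Y hYm hYm hYb hYb
  have hcenXY : ∀ j s, P (Sq j) s (fun V => X V - E (Sq j) X) (fun V => Y V - E (Sq j) Y) =
      P (Sq j) s X Y - (starRingEnd ℂ) (E (Sq j) X) * E (Sq j) Y := fun j s => hcen j s X Y hXm hYm hXb hYb
  -- (a) diagonal pairings of the centred observables are real and non-negative
  have haX : ∀ j s, v + s + 2 ≤ Sq j → (P (Sq j) s X X - (starRingEnd ℂ) (E (Sq j) X) * E (Sq j) X).im = 0 ∧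
      0 ≤ (P (Sq j) s X X - (starRingEnd ℂ) (E (Sq j) X) * E (Sq j) X).re := fun j s hs => by
    have h := (hRP j).1 s hs
    have h2 := hcenXX j s
    simp only [hP, hE] at h h2 ⊢
    rwa [h2] at h
  have haY : ∀ j s, v + s + 2 ≤ Sq j → (P (Sq j) s Y Y - (starRingEnd ℂ) (E (Sq j) Y) * E (Sq j) Y).im = 0 ∧
      0 ≤ (P (Sq j) s Y Y - (starRingEnd ℂ) (E (Sq j) Y) * E (Sq j) Y).re := fun j s hs => by
    have h := hRPY j s hs
    have h2 := hcenYY j s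
    simp only [hP, hE] at h h2 ⊢
    rwa [h2] at h
  -- (b) midpoint log-convexity of the real diagonal sequence
  have hbX : ∀ j s, v + s + 3 ≤ Sq j →
      (P (Sq j) (s + 1) X X - (starRingEnd ℂ) (E (Sq j) X) * E (Sq j) X).re ^ 2 ≤
        (P (Sq j) s X X - (starRingEnd ℂ) (E (Sq j) X) * E (Sq j) X).re *
          (P (Sq j) (s + 2) X X - (starRingEnd ℂ) (E (Sq j) X) * E (Sq j) X).re := fun j s hs => by
    have h := (hRP j).2.1 s hs
    have h2a := hcenXX j s
    have h2b := hcenXX j (s + 1)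
    have h2c := hcenXX j (s + 2)
    have him := (haX j (s + 1) (by omega)).1
    simp only [hP, hE] at h h2a h2b h2c him ⊢
    rw [h2a, h2b, h2c, Complex.sq_norm, Complex.normSq_apply, him, mul_zero, add_zero, ← sq] at h
    exact h
  -- (c) the cross term
  have hcXY : ∀ j, v + σ + 2 ≤ Sq j →
      ‖P (Sq j) σ X Y - (starRingEnd ℂ) (E (Sq j) X) * E (Sq j) Y‖ ^ 2 ≤
        (P (Sq j) (2 * σ) X X - (starRingEnd ℂ) (E (Sq j) X) * E (Sq j) X).re *
          (P (Sq j) 0 Y Y - (starRingEnd ℂ) (E (Sq j) Y) * E (Sq j) Y).re := fun j hs => by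
    have h := (hRP j).2.2 σ 0 (by omega)
    have h2a := hcenXY j σ
    have h2b := hcenXX j (2 * σ)
    have h2c := hcenYY j 0
    simp only [add_zero, mul_zero] at h
    simp only [hP, hE] at h h2a h2b h2c ⊢
    rw [h2a, h2b, h2c] at h
    exact h
  -- the far bound from the lock
  obtain ⟨C₁₃, hC₁₃⟩ := hlock A₁ A₃
  obtain ⟨C₂₄, hC₂₄⟩ := hlock A₂ A₄
  obtain ⟨C₁₄, hC₁₄⟩ := hlock A₁ A₄
  obtain ⟨C₂₃, hC₂₃⟩ := hlock A₂ A₃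
  have hfarX : ∀ j n, n ≤ Sq j → ‖P (Sq j) n X X - (starRingEnd ℂ) (E (Sq j) X) * E (Sq j) X‖ ≤
      (C₁₃ + C₂₄ + C₁₄ + C₂₃) * Real.exp (-(μ * n)) := fun j n hn => by
    have h := ivcs_far_bound r.ρ r.continuous β (Sq j) hXm hXb A₁ A₂ A₃ A₄ h₁ h₂ h₃ h₄ n
    have e1 := hC₁₃ (Sq j) n (hS₁ j) hn
    have e2 := hC₂₄ (Sq j) n (hS₁ j) hn
    have e3 := hC₁₄ (Sq j) n (hS₁ j) hn
    have e4 := hC₂₃ (Sq j) n (hS₁ j) hn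
    simp only [hP, hE]
    linarith
  -- shift the index so that `v + 3 ≤ Sq j`, and define the abstract sequences
  have hSqge : ∀ j, v + 3 ≤ Sq (j + (v + 3)) := fun j => le_trans (Nat.le_add_left _ _) (hSq.id_le (j + (v + 3)))
  set ν : ℕ → ℕ := fun j => Sq (j + (v + 3)) - (v + 3) with hν
  have hνeq : ∀ j, v + ν j + 3 = Sq (j + (v + 3)) := fun j => by
    have := hSqge j; simp only [hν]; omega
  have hνt : Tendsto ν atTop atTop := by
    refine tendsto_atTop_mono (fun j => ?_) tendsto_id
    have := hSq.id_le (j + (v + 3)); simp only [hν, id] at this ⊢; omega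
  set g : ℕ → ℕ → ℝ := fun j s =>
    (P (Sq (j + (v + 3))) s X X - (starRingEnd ℂ) (E (Sq (j + (v + 3))) X) * E (Sq (j + (v + 3))) X).re with hg
  set h0 : ℕ → ℝ := fun j =>
    (P (Sq (j + (v + 3))) 0 Y Y - (starRingEnd ℂ) (E (Sq (j + (v + 3))) Y) * E (Sq (j + (v + 3))) Y).re with hh0
  set c : ℕ → ℂ := fun j =>
    P (Sq (j + (v + 3))) σ X Y - (starRingEnd ℂ) (E (Sq (j + (v + 3))) X) * E (Sq (j + (v + 3))) Y with hc
  have hshift : Tendsto (fun j : ℕ => j + (v + 3)) atTop atTop := tendsto_add_atTop_nat _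
  have hmain := ivcs_abstract μ (C₁₃ + C₂₄ + C₁₄ + C₂₃) σ ν g
    (fun s => (lXX s - (starRingEnd ℂ) eX * eX).re) h0 ((lYY - (starRingEnd ℂ) eY * eY).re) c
    (lXY - (starRingEnd ℂ) eX * eY) hμ hνt
    (fun j s hs => (haX (j + (v + 3)) s (by have := hνeq j; omega)).2)
    (fun j s hs => hbX (j + (v + 3)) s (by have := hνeq j; omega))
    (fun j => by
      have hle : ν j ≤ Sq (j + (v + 3)) := by have := hνeq j; omega
      have hνj : v + ν j + 2 ≤ Sq (j + (v + 3)) := by have := hνeq j; omega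
      have hre := (haX (j + (v + 3)) (ν j) hνj).1
      exact (le_abs_self _).trans ((Complex.abs_re_le_norm _).trans (hfarX (j + (v + 3)) (ν j) hle)))
    (fun s => (Complex.continuous_re.tendsto _).comp
      (((hlXX s).comp hshift).sub (((Complex.continuous_conj.tendsto _).comp (heX.comp hshift)).mul
        (heX.comp hshift))))
    (fun j => (haY (j + (v + 3)) 0 (by have := hSqge j; omega)).2)
    ((Complex.continuous_re.tendsto _).comp
      ((hlYY.comp hshift).sub (((Complex.continuous_conj.tendsto _).comp (heY.comp hshift)).mul
        (heY.comp hshift))))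
    ((hlXY.comp hshift).sub (((Complex.continuous_conj.tendsto _).comp (heX.comp hshift)).mul
      (heY.comp hshift)))
    (by
      filter_upwards [eventually_ge_atTop σ] with j hj
      exact hcXY (j + (v + 3)) (by have := hSq.id_le (j + (v + 3)); simp only [id] at this; omega))
    hε
  -- unshift
  have h2 := (tendsto_sub_atTop_nat (v + 3)).eventually hmain
  filter_upwards [h2, eventually_ge_atTop (v + 3)] with j hj hjge
  have hjj : j - (v + 3) + (v + 3) = j := Nat.sub_add_cancel hjge
  simpa only [hg, hh0, hc, hjj] using hj



/-- `stub_csclIvCS` (registered signature, reshape 18): lock + reflection positivity ⇒ asymptotic OS Cauchy–Schwarz clustering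
along growing tori, constants-free (see the module docstring). [folklore] -/
theorem stub_csclIvCS :
    ∀ (G : Type) [Group G] [TopologicalSpace G] [IsTopologicalGroup G] [CompactSpace G]
      [MeasurableSpace G] [BorelSpace G] (r : LatticeRep G) (β μ : ℝ) (S₁ v : ℕ) (Sq : ℕ → ℕ)
      (X Y : LGConfig 4 G → ℂ) (ΛX ΛY : Finset (Literature.MathematicalPhysics.QuantumLattice.ZdEdge 4)),
      0 ≤ β → 0 < μ → StrictMono Sq → (∀ j, S₁ ≤ Sq j) →
      Measurable X → Measurable Y → (∃ C : ℝ, ∀ V, ‖X V‖ ≤ C) → (∃ C : ℝ, ∀ V, ‖Y V‖ ≤ C) →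
      IsCylinder X ΛX → IsCylinder Y ΛY →
      (∀ e ∈ ΛX, 1 ≤ e.1 0 ∧ e.1 0 ≤ (v : ℤ)) → (∀ e ∈ ΛY, 1 ≤ e.1 0 ∧ e.1 0 ≤ (v : ℤ)) →
      (∀ A B : YMSpecies G, ∃ C : ℝ, ∀ S n : ℕ, S₁ ≤ S → n ≤ S →
        |latticeConnectedCorr r.ρ β (2 * S + 1) A.F B.F n| ≤ C * Real.exp (-(μ * n))) →
      (∃ A₁ A₂ A₃ A₄ : YMSpecies G,
        (∀ V, A₁.F V = (X (cfgReflect V)).re) ∧ (∀ V, A₂.F V = (X (cfgReflect V)).im) ∧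
        (∀ V, A₃.F V = (X V).re) ∧ (∀ V, A₄.F V = (X V).im)) →
      (∀ σ : ℕ,
        (∃ l : ℂ, Tendsto (fun j : ℕ => ∫ U : GaugeConfig 4 (2 * Sq j + 1) G, (starRingEnd ℂ) (X (cfgReflect (torusLift (2 * Sq j + 1) U))) * X (configShift (-(Pi.single 0 ((σ : ℕ) : ℤ))) (torusLift (2 * Sq j + 1) U)) ∂(wilsonMeasure r.ρ β)) atTop (𝓝 l)) ∧
        (∃ l : ℂ, Tendsto (fun j : ℕ => ∫ U : GaugeConfig 4 (2 * Sq j + 1) G, (starRingEnd ℂ) (Y (cfgReflect (torusLift (2 * Sq j + 1) U))) * Y (configShift (-(Pi.single 0 ((σ : ℕ) : ℤ))) (torusLift (2 * Sq j + 1) U)) ∂(wilsonMeasure r.ρ β)) atTop (𝓝 l)) ∧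
        (∃ l : ℂ, Tendsto (fun j : ℕ => ∫ U : GaugeConfig 4 (2 * Sq j + 1) G, (starRingEnd ℂ) (X (cfgReflect (torusLift (2 * Sq j + 1) U))) * Y (configShift (-(Pi.single 0 ((σ : ℕ) : ℤ))) (torusLift (2 * Sq j + 1) U)) ∂(wilsonMeasure r.ρ β)) atTop (𝓝 l))) →
      (∃ l : ℂ, Tendsto (fun j : ℕ => ∫ U : GaugeConfig 4 (2 * Sq j + 1) G, X (torusLift (2 * Sq j + 1) U) ∂(wilsonMeasure r.ρ β)) atTop (𝓝 l)) →
      (∃ l : ℂ, Tendsto (fun j : ℕ => ∫ U : GaugeConfig 4 (2 * Sq j + 1) G, Y (torusLift (2 * Sq j + 1) U) ∂(wilsonMeasure r.ρ β)) atTop (𝓝 l)) →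
      ∀ (σ : ℕ) (ε : ℝ), 0 < ε → ∀ᶠ j : ℕ in atTop,
        ‖(∫ U : GaugeConfig 4 (2 * Sq j + 1) G, (starRingEnd ℂ) (X (cfgReflect (torusLift (2 * Sq j + 1) U))) * Y (configShift (-(Pi.single 0 ((σ : ℕ) : ℤ))) (torusLift (2 * Sq j + 1) U)) ∂(wilsonMeasure r.ρ β)) -
            (starRingEnd ℂ) (∫ U : GaugeConfig 4 (2 * Sq j + 1) G, X (torusLift (2 * Sq j + 1) U) ∂(wilsonMeasure r.ρ β)) * (∫ U : GaugeConfig 4 (2 * Sq j + 1) G, Y (torusLift (2 * Sq j + 1) U) ∂(wilsonMeasure r.ρ β))‖ ≤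
          Real.exp (-(μ * σ)) *
            Real.sqrt ((∫ U : GaugeConfig 4 (2 * Sq j + 1) G, (starRingEnd ℂ) (X (cfgReflect (torusLift (2 * Sq j + 1) U))) * X (configShift (-(Pi.single 0 ((0 : ℕ) : ℤ))) (torusLift (2 * Sq j + 1) U)) ∂(wilsonMeasure r.ρ β)) -
              (starRingEnd ℂ) (∫ U : GaugeConfig 4 (2 * Sq j + 1) G, X (torusLift (2 * Sq j + 1) U) ∂(wilsonMeasure r.ρ β)) * (∫ U : GaugeConfig 4 (2 * Sq j + 1) G, X (torusLift (2 * Sq j + 1) U) ∂(wilsonMeasure r.ρ β))).re *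
            Real.sqrt ((∫ U : GaugeConfig 4 (2 * Sq j + 1) G, (starRingEnd ℂ) (Y (cfgReflect (torusLift (2 * Sq j + 1) U))) * Y (configShift (-(Pi.single 0 ((0 : ℕ) : ℤ))) (torusLift (2 * Sq j + 1) U)) ∂(wilsonMeasure r.ρ β)) -
              (starRingEnd ℂ) (∫ U : GaugeConfig 4 (2 * Sq j + 1) G, Y (torusLift (2 * Sq j + 1) U) ∂(wilsonMeasure r.ρ β)) * (∫ U : GaugeConfig 4 (2 * Sq j + 1) G, Y (torusLift (2 * Sq j + 1) U) ∂(wilsonMeasure r.ρ β))).re + ε :=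
  ivcs_main

end Summit.QuantumFields.YangMills.Theorems.ContinuumLegGivenGap

end
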